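import Mathlib
import Literature.Analysis.FluidPDE.QuasiStaticSlotWeight
import HarnessLib

/-!
# K1L_D (stmt-AnomalousDissipation-27980), W7 ENGINE S1b — the SLOT ENVELOPE package (trapezoid: Lipschitz, AC, a.e. derivative, values, `∫A²`)
# (helper; `--supports stmt-AnomalousDissipation-27980 --as helper`)

The abstract slot step `W7Slot.slot_step` consumes an envelope `A` on `[t₀, t₁]` that is continuous and absolutely continuous, with
`0 ≤ A ≤ 1`, `A(t₀) = A(t₁) = 0`, an a.e. derivative `Ȧ` with `Ȧ² ≤ 4/(t₁−t₀)²`, and (for the slot floor) `∫A² = (t₁−t₀)/3`.  For the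
cell carrier these are the facts of the tree's trapezoid `LatticeShear.LatticeWord.trapezoid a τ ρ` (ramps `ρτ`, `0 < ρ ≤ 1/2`; the cubature
word has `ρ = 1/2`, the triangle), proved here once (no named right-derivative profile is needed: the a.e. derivative is packaged existentially):
* `trapezoid_left`, `trapezoid_right` — endpoint values (`0 ≤ · ≤ 1`, continuity: `PermissibleCarrier.trapezoid_nonneg/_le_one/continuous_trapezoid`);
* `lipschitzWith_trapezoid`, `absolutelyContinuousOnInterval_trapezoid`;
* **`exists_ae_hasDerivAt_trapezoid`** — `∃ Ȧ, (∀ t, Ȧ t² ≤ (1/(ρτ))²) ∧ ∀ᵐ t, HasDerivAt (trapezoid a τ ρ) (Ȧ t) t`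
  (piecewise affine; the four kinks are a null set);
* `integral_trapezoid_sq_anchored` — `∫_a^{a+τ} trapezoid² = τ(1 − 4ρ/3)` (shift of `LatticeShear.integral_trapezoid_sq`).
W7 assembly owner: prover ad-sawtooth-k1loc-p1 g11 (spine of record: planner ad-ideate-p5 g10, `Lines/onelevel_W7_engine.lean` §4).  No definitions, no sorry.
NOT a proof of the crux / of AD; rung F-D1.A0. [cite: ArmstrongVicol2025, §4 p. 17 (time cutoff)] [problem: turb]
-/

set_option linter.dupNamespace false

namespace Summit.AnomalousDissipation.AnomalousDissipation.Theorems.SolenoidalFractalHomogenisation.LagrangianStep.W7Engine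

open Set Real MeasureTheory intervalIntegral Filter Topology
open Literature.Analysis.FluidPDE Literature.Analysis.FluidPDE.LatticeShear
open scoped NNReal

/-! ## §1 Values (`0 ≤ trapezoid ≤ 1` and continuity are `PermissibleCarrier.trapezoid_nonneg/_le_one/continuous_trapezoid`
in `Theorems/SolenoidalFractalHomogenisationPermissibleFractalCarrierLayers.lean` — not restated) -/

/-- The envelope vanishes at the slot start. [cite: ArmstrongVicol2025, §4 p. 17 (time cutoff)] -/
theorem trapezoid_left {τ ρ : ℝ} (hτ : 0 < τ) (hρ : 0 < ρ) (a : ℝ) : LatticeWord.trapezoid a τ ρ a = 0 := by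
  rw [trapezoid_shift, sub_self]; exact trapezoid_eq_zero_of_nonpos hτ hρ le_rfl

/-- The envelope vanishes at the slot end. [cite: ArmstrongVicol2025, §4 p. 17 (time cutoff)] -/
theorem trapezoid_right {τ ρ : ℝ} (hτ : 0 < τ) (hρ : 0 < ρ) (a : ℝ) : LatticeWord.trapezoid a τ ρ (a + τ) = 0 := by
  rw [trapezoid_shift, show a + τ - a = τ by ring]; exact trapezoid_eq_zero_of_tau_le hτ hρ le_rfl

/-! ## §2 Lipschitz continuity, absolute continuity -/

/-- The trapezoid is Lipschitz with constant `1/(ρτ)`. [cite: ArmstrongVicol2025, §4 p. 17 (time cutoff)] -/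
theorem lipschitzWith_trapezoid (a : ℝ) {τ ρ : ℝ} (hτ : 0 < τ) (hρ : 0 < ρ) :
    LipschitzWith (Real.toNNReal (1 / (ρ * τ))) (fun s => LatticeWord.trapezoid a τ ρ s) := by
  have hr : 0 < ρ * τ := mul_pos hρ hτ
  have hK : ((Real.toNNReal (1 / (ρ * τ)) : ℝ≥0) : ℝ) = 1 / (ρ * τ) := Real.coe_toNNReal _ (by positivity)
  have hf : LipschitzWith (Real.toNNReal (1 / (ρ * τ))) (fun s : ℝ => (s - a) / (ρ * τ)) := by
    refine LipschitzWith.of_dist_le_mul fun x y => ?_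
    rw [hK, Real.dist_eq, Real.dist_eq, show (x - a) / (ρ * τ) - (y - a) / (ρ * τ) = (x - y) / (ρ * τ) by ring, abs_div,
      abs_of_pos hr]
    exact le_of_eq (by ring)
  have hg : LipschitzWith (Real.toNNReal (1 / (ρ * τ))) (fun s : ℝ => (a + τ - s) / (ρ * τ)) := by
    refine LipschitzWith.of_dist_le_mul fun x y => ?_
    rw [hK, Real.dist_eq, Real.dist_eq, show (a + τ - x) / (ρ * τ) - (a + τ - y) / (ρ * τ) = -((x - y) / (ρ * τ)) by ring,
      abs_neg, abs_div, abs_of_pos hr]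
    exact le_of_eq (by ring)
  have hmin := hf.min hg
  rw [max_self] at hmin
  have h2 := (hmin.const_min 1).const_max 0
  simpa only [LatticeWord.trapezoid] using h2

/-- The trapezoid is absolutely continuous on every interval. [cite: ArmstrongVicol2025, §4 p. 17 (time cutoff)] -/
theorem absolutelyContinuousOnInterval_trapezoid (a : ℝ) {τ ρ : ℝ} (hτ : 0 < τ) (hρ : 0 < ρ) (b c : ℝ) :
    AbsolutelyContinuousOnInterval (fun s => LatticeWord.trapezoid a τ ρ s) b c :=
  ((lipschitzWith_trapezoid a hτ hρ).lipschitzOnWith (s := uIcc b c)).absolutelyContinuousOnInterval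

/-! ## §3 The a.e. derivative -/

/-- **A.e. derivative of the trapezoid** (piecewise affine): there is `Ȧ` with `Ȧ² ≤ (1/(ρτ))²` everywhere and
`HasDerivAt (trapezoid a τ ρ) (Ȧ t) t` for a.e. `t`. [cite: ArmstrongVicol2025, §4 p. 17 (time cutoff)] -/
theorem exists_ae_hasDerivAt_trapezoid (a : ℝ) {τ ρ : ℝ} (hτ : 0 < τ) (hρ : 0 < ρ) (hρ2 : ρ ≤ 1 / 2) :
    ∃ Ad : ℝ → ℝ, (∀ t, Ad t ^ 2 ≤ (1 / (ρ * τ)) ^ 2) ∧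
      ∀ᵐ t, HasDerivAt (fun s => LatticeWord.trapezoid a τ ρ s) (Ad t) t := by
  classical
  have hr : 0 < ρ * τ := mul_pos hρ hτ
  refine ⟨fun t => if t ∈ Ioo a (a + ρ * τ) then 1 / (ρ * τ) else if t ∈ Ioo (a + τ - ρ * τ) (a + τ) then -(1 / (ρ * τ)) else 0,
    fun t => ?_, ?_⟩
  · by_cases h1 : t ∈ Ioo a (a + ρ * τ)
    · simp [h1]
    · by_cases h2 : t ∈ Ioo (a + τ - ρ * τ) (a + τ)
      · simp [h1, h2]
      · simp [h1, h2]; positivity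
  -- off the four kinks the function is locally affine
  have hnull : volume ({a, a + ρ * τ, a + τ - ρ * τ, a + τ} : Set ℝ) = 0 := by
    refine Set.Finite.measure_zero ?_ _
    simp
  have hae : ∀ᵐ t : ℝ, t ∉ ({a, a + ρ * τ, a + τ - ρ * τ, a + τ} : Set ℝ) := compl_mem_ae_iff.2 hnull
  filter_upwards [hae] with t ht
  simp only [mem_insert_iff, mem_singleton_iff, not_or] at ht
  obtain ⟨h1, h2, h3, h4⟩ := ht
  -- the shifted variable
  have hshift : ∀ s, LatticeWord.trapezoid a τ ρ s = LatticeWord.trapezoid 0 τ ρ (s - a) := fun s => trapezoid_shift a τ ρ s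
  rcases lt_or_gt_of_ne h1 with hlt | hgt
  · -- `t < a`: locally zero
    have hev : (fun s => LatticeWord.trapezoid a τ ρ s) =ᶠ[𝓝 t] fun _ => (0:ℝ) := by
      filter_upwards [Iio_mem_nhds hlt] with s hs
      rw [hshift]; exact trapezoid_eq_zero_of_nonpos hτ hρ (by linarith [mem_Iio.1 hs])
    have h0 : ¬ t ∈ Ioo a (a + ρ * τ) := fun h => absurd h.1 (not_lt.2 hlt.le)
    have h0' : ¬ t ∈ Ioo (a + τ - ρ * τ) (a + τ) := fun h => by have := h.1; nlinarith
    simp only [h0, h0', if_false]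
    exact (hasDerivAt_const t (0:ℝ)).congr_of_eventuallyEq hev
  · rcases lt_or_gt_of_ne h2 with hlt2 | hgt2
    · -- up-ramp interior
      have hmem : t ∈ Ioo a (a + ρ * τ) := ⟨hgt, hlt2⟩
      have hev : (fun s => LatticeWord.trapezoid a τ ρ s) =ᶠ[𝓝 t] fun s => (s - a) / (ρ * τ) := by
        filter_upwards [Ioo_mem_nhds hgt hlt2] with s hs
        rw [hshift]; exact trapezoid_eq_of_mem_ramp_up hτ hρ hρ2 ⟨by linarith [hs.1], by linarith [hs.2]⟩
      simp only [hmem, if_true]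
      have hd : HasDerivAt (fun s : ℝ => (s - a) / (ρ * τ)) (1 / (ρ * τ)) t := by
        have := ((hasDerivAt_id t).sub_const a).div_const (ρ * τ)
        simpa using this
      exact hd.congr_of_eventuallyEq hev
    · rcases lt_or_gt_of_ne h3 with hlt3 | hgt3
      · -- plateau interior
        have hev : (fun s => LatticeWord.trapezoid a τ ρ s) =ᶠ[𝓝 t] fun _ => (1:ℝ) := by
          filter_upwards [Ioo_mem_nhds hgt2 hlt3] with s hs
          rw [hshift]; exact trapezoid_eq_of_mem_plateau hτ hρ ⟨by linarith [hs.1], by linarith [hs.2]⟩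
        have h0 : ¬ t ∈ Ioo a (a + ρ * τ) := fun h => absurd h.2 (not_lt.2 hgt2.le)
        have h0' : ¬ t ∈ Ioo (a + τ - ρ * τ) (a + τ) := fun h => absurd h.1 (not_lt.2 hlt3.le)
        simp only [h0, h0', if_false]
        exact (hasDerivAt_const t (1:ℝ)).congr_of_eventuallyEq hev
      · rcases lt_or_gt_of_ne h4 with hlt4 | hgt4
        · -- down-ramp interior
          have hmem : t ∈ Ioo (a + τ - ρ * τ) (a + τ) := ⟨hgt3, hlt4⟩
          have hnot : ¬ t ∈ Ioo a (a + ρ * τ) := fun h => by have := h.2; nlinarith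
          have hev : (fun s => LatticeWord.trapezoid a τ ρ s) =ᶠ[𝓝 t] fun s => (τ - (s - a)) / (ρ * τ) := by
            filter_upwards [Ioo_mem_nhds hgt3 hlt4] with s hs
            rw [hshift]; exact trapezoid_eq_of_mem_ramp_down hτ hρ hρ2 ⟨by linarith [hs.1], by linarith [hs.2]⟩
          simp only [hnot, hmem, if_false, if_true]
          have hd : HasDerivAt (fun s : ℝ => (τ - (s - a)) / (ρ * τ)) (-(1 / (ρ * τ))) t := by
            have h := ((hasDerivAt_const t τ).sub ((hasDerivAt_id t).sub_const a)).div_const (ρ * τ)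
            have hv : ((0:ℝ) - 1) / (ρ * τ) = -(1 / (ρ * τ)) := by ring
            rw [hv] at h
            exact h
          exact hd.congr_of_eventuallyEq hev
        · -- after the slot
          have hev : (fun s => LatticeWord.trapezoid a τ ρ s) =ᶠ[𝓝 t] fun _ => (0:ℝ) := by
            filter_upwards [Ioi_mem_nhds hgt4] with s hs
            rw [hshift]; exact trapezoid_eq_zero_of_tau_le hτ hρ (by linarith [mem_Ioi.1 hs])
          have h0 : ¬ t ∈ Ioo a (a + ρ * τ) := fun h => by have := h.2; nlinarith
          have h0' : ¬ t ∈ Ioo (a + τ - ρ * τ) (a + τ) := fun h => absurd h.2 (not_lt.2 hgt4.le)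
          simp only [h0, h0', if_false]
          exact (hasDerivAt_const t (0:ℝ)).congr_of_eventuallyEq hev

/-! ## §4 The square integral over the slot -/

/-- `∫_a^{a+τ} trapezoid² = τ(1 − 4ρ/3)` (`= τ/3` for the triangle `ρ = 1/2`). [cite: ArmstrongVicol2025, §4 p. 17 (∫ζ²)] -/
theorem integral_trapezoid_sq_anchored (a : ℝ) {τ ρ : ℝ} (hτ : 0 < τ) (hρ : 0 < ρ) (hρ2 : ρ ≤ 1 / 2) :
    ∫ s in a..(a + τ), LatticeWord.trapezoid a τ ρ s ^ 2 = τ * (1 - 4 * ρ / 3) := by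
  have h := integral_trapezoid_sq hτ hρ hρ2
  have hs : ∫ s in a..(a + τ), LatticeWord.trapezoid a τ ρ s ^ 2
      = ∫ s in a..(a + τ), (fun x => LatticeWord.trapezoid 0 τ ρ x ^ 2) (s - a) := by
    congr 1; funext s; simp only [trapezoid_shift a τ ρ s]
  rw [hs, intervalIntegral.integral_comp_sub_right (fun x => LatticeWord.trapezoid 0 τ ρ x ^ 2) a]
  simpa using h

end Summit.AnomalousDissipation.AnomalousDissipation.Theorems.SolenoidalFractalHomogenisation.LagrangianStep.W7Engine
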